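import Summits.Ventures.PercRepro2.CaseOneGadgetUWOBMixA
import Summits.Ventures.PercRepro2.CaseOneGadgetUWOBMixB
import Summits.Ventures.PercRepro2.CaseOnePendantAnyI

/-!
# The gadget `u ~ {w, o, b}`, `w ~ {u, a₁, a₂}`: the bridge from the forms to the polynomials
(blind cell PercRepro2, p1 g16; S5 §2.1 (K9) (l))

`sg*_mix`: each mass polynomial at the cell masses of the pinned law is the thirty-two-term mixture of
`massg_*`; hence **`iiExpr_eq_iiG5`**, **`iiExprT_eq_iiqG5`**, **`iExpr_eq_iG5`**, **`iExprT_eq_iqG5`**: the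
four case-1 forms at `u` are the gadget polynomials at the five edge weights and the cell masses of
`pin5 p`. With `iiG5 ≥ 0` etc. on the cube under `SFacts` (the certificate layer) they give `(ii)`, `(ii-Q)`,
`(i)`, `(i-Q)` at `u` for every finite graph and every weight vector. -/

namespace Summit.Ventures.PercRepro2

namespace CaseOne

section BridgeG5
variable {V : Type*} {E : Type*} [Fintype E] [DecidableEq E] {R : Type*} [Field R]
variable {ends : E → Sym2 V} {o a₁ a₂ b u w : V} {euw euo eub ewa1 ewa2 : E}

/-- **`iiExpr` at `u` is `iiG5`** at the five edge weights and the cell masses of the pinned law. -/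
theorem iiExpr_eq_iiG5 (p : E → R) (h : IsGadgetUWOB ends o a₁ a₂ b u w euw euo eub ewa1 ewa2) :
    iiExpr p ends o a₁ a₂ u b =
      iiG5 (p euw) (p euo) (p eub) (p ewa1) (p ewa2) (scells (pin5 p euw euo eub ewa1 ewa2) ends o a₁ a₂ b) := by
  rw [iiExpr_eq_probs, massg_Q p h, massg_QB p h, massg_QA p h, massg_QAO p h, massg_QAB p h, massg_QABO p h,
    massg_D p h, massg_Do p h, ← sgQ_mix p euw euo eub ewa1 ewa2, ← sgQB_mix p euw euo eub ewa1 ewa2,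
    ← sgQA_mix p euw euo eub ewa1 ewa2, ← sgQAO_mix p euw euo eub ewa1 ewa2, ← sgQAB_mix p euw euo eub ewa1 ewa2,
    ← sgQABO_mix p euw euo eub ewa1 ewa2, ← sgD_mix p euw euo eub ewa1 ewa2, ← sgDo_mix p euw euo eub ewa1 ewa2]
  rfl

/-- **The Q-threshold form at `u` is `iiqG5`**. -/
theorem iiExprT_eq_iiqG5 (p : E → R) (h : IsGadgetUWOB ends o a₁ a₂ b u w euw euo eub ewa1 ewa2) :
    iiExprT p ends o a₁ a₂ u b (Dqo p ends o a₁ a₂) (prob p (connEvent ends a₁ a₂)ᶜ) =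
      iiqG5 (p euw) (p euo) (p eub) (p ewa1) (p ewa2) (scells (pin5 p euw euo eub ewa1 ewa2) ends o a₁ a₂ b) := by
  rw [iiExprT_eq, massg_Q p h, massg_QB p h, massg_QA p h, massg_QAO p h, massg_QAB p h, massg_QABO p h,
    massg_YU p h, ← sgQ_mix p euw euo eub ewa1 ewa2, ← sgQB_mix p euw euo eub ewa1 ewa2,
    ← sgQA_mix p euw euo eub ewa1 ewa2, ← sgQAO_mix p euw euo eub ewa1 ewa2, ← sgQAB_mix p euw euo eub ewa1 ewa2,
    ← sgQABO_mix p euw euo eub ewa1 ewa2, ← sgYU_mix p euw euo eub ewa1 ewa2]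
  rfl

/-- **`iExpr` at `u` is `iG5`**. -/
theorem iExpr_eq_iG5 (p : E → R) (h : IsGadgetUWOB ends o a₁ a₂ b u w euw euo eub ewa1 ewa2) :
    iExpr p ends o a₁ a₂ u b =
      iG5 (p euw) (p euo) (p eub) (p ewa1) (p ewa2) (scells (pin5 p euw euo eub ewa1 ewa2) ends o a₁ a₂ b) := by
  rw [iExpr_eq_iExprT, iExprT_eq, massg_Q p h, massg_QA p h, massg_QAO p h, massg_D p h, massg_Do p h,
    massg_QB1 p h, massg_QAB1 p h, massg_QAB1O p h, ← sgQ_mix p euw euo eub ewa1 ewa2,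
    ← sgQA_mix p euw euo eub ewa1 ewa2, ← sgQAO_mix p euw euo eub ewa1 ewa2, ← sgD_mix p euw euo eub ewa1 ewa2,
    ← sgDo_mix p euw euo eub ewa1 ewa2, ← sgQB1_mix p euw euo eub ewa1 ewa2, ← sgQAB1_mix p euw euo eub ewa1 ewa2,
    ← sgQAB1O_mix p euw euo eub ewa1 ewa2]
  rfl

/-- **The `(i)`-side Q-threshold form at `u` is `iqG5`**. -/
theorem iExprT_eq_iqG5 (p : E → R) (h : IsGadgetUWOB ends o a₁ a₂ b u w euw euo eub ewa1 ewa2) :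
    iExprT p ends o a₁ a₂ u b (Dqo p ends o a₁ a₂) (prob p (connEvent ends a₁ a₂)ᶜ) =
      iqG5 (p euw) (p euo) (p eub) (p ewa1) (p ewa2) (scells (pin5 p euw euo eub ewa1 ewa2) ends o a₁ a₂ b) := by
  rw [iExprT_eq, massg_Q p h, massg_QA p h, massg_QAO p h, massg_YU p h, massg_QB1 p h, massg_QAB1 p h,
    massg_QAB1O p h, ← sgQ_mix p euw euo eub ewa1 ewa2, ← sgQA_mix p euw euo eub ewa1 ewa2,
    ← sgQAO_mix p euw euo eub ewa1 ewa2, ← sgYU_mix p euw euo eub ewa1 ewa2, ← sgQB1_mix p euw euo eub ewa1 ewa2,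
    ← sgQAB1_mix p euw euo eub ewa1 ewa2, ← sgQAB1O_mix p euw euo eub ewa1 ewa2]
  rfl

end BridgeG5

end CaseOne

end Summit.Ventures.PercRepro2
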